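import Summits.QuantumFields.YangMills.Theorems.BalabanUVNodesN27AtRecord13CoPHHolder
import Summits.QuantumFields.YangMills.Theorems.BalabanUVNodesN16OfSocketsAllTorusAtRecord13CoPH

/-!
# BalabanUVNodes ∕ N27 = binder B5 AT THE RECORD — THE READING STOREY AT NODE N16's CURRENCY OF RECORD «R-β» WITH THE N16 SLOT PRODUCED FROM NODE N05's FIVE SOCKETS AT EXPONENT `β`
# + N07's LINEAR LEAF, LETTERS CHOSEN (dag-n16-e 38ᴴ `…N16OfSocketsAllTorusAtRecord13CoPH` §2 `exists_letters_s_N16Holder_readingOfRecord₁₃CoPHOn_of_sockets_allTorus (hβ0 hβ1) (hg) (hS) (h7)`, p546057-era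
# module of record): the SOCKETS twin of (Q) §3 `spine_rec13CCoPHOn_at_readingOfRecord₁₃CoPH_holder_of_thm33Letters` and the sibling of this seat's EDGES twin `…HolderN16Edges` (p585820) — node N05's
# five SOCKETS `SockP5base ∕ SockP5 ∕ SockH59 ∕ SockP5uE ∕ SockB9P3` (the [Balaban1985RegularSpaces] Prop 5 ∕ (1.59) ∕ unit-eq ∕ [B9] Prop 3 faces in the tree's dress, `SockB9P3` at exponent `β`) on the
# pinned all-torus proper sub-index, with the socket constants' window, in place of node N06's Theorem 3.3 + dictionary + letters
# (cell `pub-ymgap`, HUMAN RULING D-0062 Track A; director-ym №197 ∕ HUMAN RULING D-0149 width seats; seat `pub-ymgap-dag-n17-w3` on row N27 (W-a) by plan g78∕g79 W-SEAT-START-LIST v4∕v5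
# («UNOWNED ×3, one leaf each …HolderN16{Window,Edges,Sockets}»); K3⁷ `SpineGivenEndpointR13SepCoPH` = stmt-QuantumFields-20544, `--kind proof --supports 20544 --as helper`; COUNT-NEUTRAL; THEOREMS ONLY,
# 0 `def`, 0 `sorry`; `N`-generic, regime-generic, NO Theses import — the item-facing face is the sibling route-facing leaf `…N27SpineGivenEndpointR13SepCoPHHolderN16Sockets`)

THE KIT PATTERN (plan v4∕v5 §n27: «slice the TREE parent, swap ONE producer face»).  PARENT = (Q) `…N27AtRecord13CoPHHolder` (dag-n27-c, p581033∕p584092) §2 ★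
`spine_rec13CCoPHOn_at_readingOfRecord₁₃CoPH_holder` (N27 = B5 at the regime record class from the stubs at the regime home of dag-n22-e's reading of record
`readingOfRecord₁₃CoPH w1 ℓ₃ ne2 ne1`, node N16's stub in the currency of record R-β, N17 ELIMINATED by dag-n17-a `YMDAG.N17.s_N17_of_D4_N18`, the N19′ edge reading dag-n16-e 41ᴴ's
`RatesHolderAt … β`).  THE ONE FACE SWAPPED: `h16 : S_N16Holder β (RRec₁₃CoPHOn (readingOfRecord₁₃CoPH w1 ℓ₃ ne2 ne1) Rg)` is PRODUCED by dag-n16-e 38ᴴ §2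
`exists_letters_s_N16Holder_readingOfRecord₁₃CoPHOn_of_sockets_allTorus` from `hg` (a coupling letter `g F > 0`), `hS` (per family: a length letter `len`, socket constants `C₂ B₀ B₀' cu cP B₀β`,
`inp : B8.B9Inputs` with their sign ∕ size window, and node N05's FIVE SOCKETS `SockP5base F.L B₀ B₀' cP …`, `SockP5 …`, `SockH59 …`, `SockP5uE F.L B₀ cP cu …`, `SockB9P3 F.L inp.B₀ B₀β cP β len …` on the
PINNED all-torus proper sub-index `{i : ZdIdx 4 F.L // (∀ j, i.Ω j = univ) ∧ (∀ m j, i.Λs m j = {y | j = m}) ∧ (∀ m j, i.Λb m j = {c | j = m}) ∧ i.η = (F.L⁻¹)^{i.k}}`) and `h7` (node N07's linear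
`LeafH3sup`) — 38ᴴ's binders VERBATIM as the theorem's leading binders (leaf E's display; `0 ≤ β ≤ 1`).  Since the Spine conclusion never mentions `ℓ₃`, the home-keyed N19′ edge `h19` is
asked FOR EVERY `ℓ₃`, exactly as in (Q) §3 and the EDGES twin.  EVERY OTHER BINDER AND THE CONCLUSION VERBATIM from (Q) §3; proof = `obtain ⟨ℓ₃, h16, -⟩ := 38ᴴ …` then (Q) §2 at that `ℓ₃` with
dag-n22-e's `s_N1x_rRec₁₃CoPHOn_iff` unfoldings.  (Q), 37ᴴ, 38ᴴ, 40ᴮ, leaf E, the EDGES twin and every landed declaration UNTOUCHED (additive file); nothing re-declared.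

WHAT IS KERNEL-CHECKED ([bookkeeping]; 0 `def`, 0 `sorry`):
* §1 ★★ `spine_rec13CCoPHOn_at_readingOfRecord₁₃CoPH_holder_of_sockets` — N27 = B5 at node00-def-RR-2's regime record class `IsRecordOfRecord₁₃CCoPHOn F N Rg` from: NE1′ on `ne1`, NE2 on
  `ne2`, NE5 ∕ NE9 ∕ (D4) on the reading's `u3Objects` (guarded θ-form), N16 AT EXPONENT `β` ⟸ 38ᴴ from `hβ0 hβ1 hg hS h7`, N17 eliminated, N20 ∕ N21 ∕ extraction displayed, the N19′ edge
  reading `RatesHolderAt … β` for every `ℓ₃`.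

HONEST FRAMING.  COMPOSITE-node bookkeeping BY NAME; no estimate of its own.  Node N05's five sockets ([Balaban1985RegularSpaces] Prop 5, (1.59), the unit equation, [Balaban1985BackgroundPropagators]
Prop 3 in the tree's `Sock…` dress at exponent `β`), node N07's linear `LeafH3sup`, NE1′ ∕ NE2 ∕ NE5 ∕ NE9 ∕ (D4), NE7 ∕ NE7b ∕ NE7c and the extraction clause are HYPOTHESES asserted for no family
(the children's open obligations; 0∕1 at the ₁₃ record today — K0⁷ OPEN, no `Provisos₁₃CoPH` inhabitant claimed); `β` a LETTER (`0 ≤ β ≤ 1` here; the consumers' window `2∕3 < β < 1` is theirs);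
NE3 at exponent β NOT PROVED; nothing of Bałaban's asserted or instantiated; N05 ∕ N07 ∕ N16 ∕ N17 ∕ N27 NOT discharged; K3⁷ NOT claimed; counts UNMOVED (typed 28∕28 · discharged 5∕27, A 5∕28).
One finite four-torus programme at fixed `ε` per run — R4 closes the conditional rung `BalabanLadder.UV` only; NOT ℝ⁴, NOT infinite volume, NOT OS, NOT a mass gap, NOT Clay.
No decl below carries a cite tag.
-/

set_option autoImplicit false

namespace Summit.QuantumFields.YangMills.Theorems.BalabanUVNodesN27SpineRecord

open scoped Matrix.Norms.L2Operator

open Literature.MathematicalPhysics.QuantumFieldTheory.Balaban1983to89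
open Literature.MathematicalPhysics.QuantumFieldTheory.Balaban1983to89.T4Continuum
open T4ContinuumYM4Torus (ForSmallCouplings)
open Summit.QuantumFields.BalabanUV.T4Continuum.Spine
open YMDAG.UVSplit
open Node00 (Stage13HParams datumOfRecord₁₃CoPH IsRecordOfRecord₁₃CCoPH IsDatumOfRecord₁₃CCoPH NE3Letters₁₁ NE2Objects₁₁ ne3ConstLayerOfRecord₁₁ MatA)
open Node00.W1 (ReadingData)
open T4WeightBudget (RelWeightBound)
open T4IndicatorShell (ShellWeightBound)
open B7Prop1Explicit B7Prop2Explicit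
open B7Prop3Flat (c3)
open B8LeafModelZd (ZdIdx SockP5base SockP5 SockH59)
open B8LeafModelZd3 (zdGF3 SockB9P3)
open B8LeafModelZdSockP5uE (SockP5uE)
open Node00 (ne3NperOfRecord₁₁ ne3DomOfRecord₁₁)
open Summit.QuantumFields.BalabanUV.T4Continuum.NE3.LeafIndexSockets (LeafH3sup)
open Summit.QuantumFields.YangMills.BalabanUVNodes.N16HolderDefs (N16HolderAt S_N16Holder)
open Summit.QuantumFields.YangMills.BalabanUVNodes.SpineRatesHolder (RatesHolderAt)
open Summit.QuantumFields.YangMills.BalabanUVNodes.N16OfSocketsAllTorusAtRecord13CoPH (exists_letters_s_N16Holder_readingOfRecord₁₃CoPHOn_of_sockets_allTorus)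

variable {N : ℕ} [NeZero N] (cr : SpineReading₁₃CoPH N)

/-! ## §1 The N16 slot AT EXPONENT `β` read off node N05's FIVE SOCKETS at exponent `β` on the pinned all-torus proper sub-index + N07's linear leaf
(dag-n16-e 38ᴴ §2, letters produced; `0 ≤ β ≤ 1`) -/

section Sockets

variable (w1 : (F : T4Family) → (θ : Stage13HParams F N) → Node00.W1.ReadingData F (Node00.MatA N) θ.τ9.M)
  (ne2 : (F : T4Family) → Stage13HParams F N → (ℕ → ℝ) → List (ULoop F) → ℕ → NE2Objects₁₁)
  (ne1 : (F : T4Family) → Stage13HParams F N → (ℕ → ℝ) → List (ULoop F) → NE1pCarriers)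

/-- ★★ **N27 = B5 AT THE REGIME RECORD CLASS FROM THE SLOTS AT THE REGIME HOME OF THE READING OF RECORD, THE N16 SLOT IN THE CURRENCY OF RECORD R-β READ OFF NODE N05's FIVE
SOCKETS AT EXPONENT `β` (`SockP5base ∕ SockP5 ∕ SockH59 ∕ SockP5uE ∕ SockB9P3` on the PINNED all-torus proper sub-index, socket constants and window) + N07's LINEAR LEAF, LETTERS PRODUCED**
((Q) §3 `spine_rec13CCoPHOn_at_readingOfRecord₁₃CoPH_holder_of_thm33Letters`'s SOCKETS twin; sibling of the EDGES twin `…_holder_of_edges`: `h16` ⟸ dag-n16-e 38ᴴ §2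
`exists_letters_s_N16Holder_readingOfRecord₁₃CoPHOn_of_sockets_allTorus hβ0 hβ1 hg hS h7`, the other rate slots in guarded θ-form (dag-n22-e `s_N1x_rRec₁₃CoPHOn_iff`), N17 eliminated
(dag-n17-a `YMDAG.N17.s_N17_of_D4_N18` inside (Q) §2), the N19′ edge reading dag-n16-e 41ᴴ's `RatesHolderAt … β` for every `ℓ₃`); at `Rg :=` the item's guard, `N = 2` THE ITEM follows in the
sibling route-facing leaf.  Every hypothesis 0∕1 today; NE3 at exponent β NOT PROVED; N05 ∕ N07 ∕ N16 ∕ N27 NOT discharged. [bookkeeping] -/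
theorem spine_rec13CCoPHOn_at_readingOfRecord₁₃CoPH_holder_of_sockets {β : ℝ} (hβ0 : 0 ≤ β) (hβ1 : β ≤ 1) {g : T4Family → ℝ} (hg : ∀ F, 0 < g F)
    (hS : ∀ F : T4Family, letI : CStarAlgebra (Matrix (Fin N) (Fin N) ℂ) := {}
      ∃ (len : Site 4 → ℝ) (C₂ B₀ B₀' cu cP B₀β : ℝ) (inp : B8.B9Inputs),
        (∀ v : Site 4, 0 < len v → 1 ≤ len v) ∧ (∀ μ : Fin 4, len (e μ) = 1) ∧
        0 < B₀ ∧ inp.B₀ ≤ B₀ ∧ 0 < B₀' ∧ 2 ≤ 5 * ((4 : ℕ) : ℝ) * F.L * B₀ ∧ 0 < cu ∧ 0 < cP ∧ 0 ≤ B₀β ∧ 2097152 * (((4 : ℕ) : ℝ) + 1) ^ 2 ≤ C₂ ∧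
        (∀ i : {i : ZdIdx 4 F.L // (∀ j, i.Ω j = Set.univ) ∧ (∀ m j, i.Λs m j = {_y | j = m}) ∧ (∀ m j, i.Λb m j = {_c | j = m}) ∧ i.η = ((F.L : ℝ)⁻¹) ^ i.k}, SockP5base (𝔸 := Matrix (Fin N) (Fin N) ℂ) F.L B₀ B₀' cP i.1.η i.1.k i.1.Ω i.1.Λs) ∧
        (∀ i : {i : ZdIdx 4 F.L // (∀ j, i.Ω j = Set.univ) ∧ (∀ m j, i.Λs m j = {_y | j = m}) ∧ (∀ m j, i.Λb m j = {_c | j = m}) ∧ i.η = ((F.L : ℝ)⁻¹) ^ i.k}, SockP5 (𝔸 := Matrix (Fin N) (Fin N) ℂ) F.L B₀ B₀' cP i.1.η i.1.k i.1.Ω i.1.Λs) ∧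
        (∀ i : {i : ZdIdx 4 F.L // (∀ j, i.Ω j = Set.univ) ∧ (∀ m j, i.Λs m j = {_y | j = m}) ∧ (∀ m j, i.Λb m j = {_c | j = m}) ∧ i.η = ((F.L : ℝ)⁻¹) ^ i.k}, SockH59 (𝔸 := Matrix (Fin N) (Fin N) ℂ) F.L B₀ B₀' cP i.1.η i.1.k i.1.Ω i.1.Λs i.1.Λb) ∧
        (∀ i : {i : ZdIdx 4 F.L // (∀ j, i.Ω j = Set.univ) ∧ (∀ m j, i.Λs m j = {_y | j = m}) ∧ (∀ m j, i.Λb m j = {_c | j = m}) ∧ i.η = ((F.L : ℝ)⁻¹) ^ i.k}, SockP5uE (𝔸 := Matrix (Fin N) (Fin N) ℂ) F.L B₀ cP cu i.1.η i.1.k i.1.Ω i.1.Λs) ∧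
        (∀ i : {i : ZdIdx 4 F.L // (∀ j, i.Ω j = Set.univ) ∧ (∀ m j, i.Λs m j = {_y | j = m}) ∧ (∀ m j, i.Λb m j = {_c | j = m}) ∧ i.η = ((F.L : ℝ)⁻¹) ^ i.k}, SockB9P3 (𝔸 := Matrix (Fin N) (Fin N) ℂ) F.L inp.B₀ B₀β cP β len i.1.η i.1.k i.1.Ω i.1.Λs i.1.Λb))
    (h7 : ∀ F : T4Family, ∃ C ε₀ : ℝ, 0 ≤ C ∧ 0 < ε₀ ∧ ∀ ε : ℝ, 0 < ε → ε ≤ ε₀ →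
      LeafH3sup 4 F.L (ne3NperOfRecord₁₁ F 0 0) ε (C * ε) (C * ε) (ne3DomOfRecord₁₁ F N 0 0))
    (Rg : (F : T4Family) → Stage13HParams F N → Prop)
    (h14 : ∀ (F : T4Family) (θ : Stage13HParams F N), θ.Provisos₁₃CoPH F N → Rg F θ → θ.Admissible F N → ∀ (g₀ : ℕ → ℝ) (os : List (ULoop F)),
      N14At (ne1 F θ g₀ os))
    (h15 : ∀ (F : T4Family) (θ : Stage13HParams F N), θ.Provisos₁₃CoPH F N → Rg F θ → θ.Admissible F N → ∀ (g₀ : ℕ → ℝ) (os : List (ULoop F)) (k : ℕ),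
      N15At (ne2OfRecord₁₁ (ne2 F θ g₀ os k)))
    (h18 : ∀ (F : T4Family) (θ : Stage13HParams F N), θ.Provisos₁₃CoPH F N → Rg F θ → θ.Admissible F N → ∀ k : ℕ,
      N18At (u3OfRecord₁₃ θ.toStage13Params ((w1 F θ).u3Objects θ.γ) k))
    (h22 : ∀ (F : T4Family) (θ : Stage13HParams F N), θ.Provisos₁₃CoPH F N → Rg F θ → θ.Admissible F N → ∀ k : ℕ,
      N22At (u3OfRecord₁₃ θ.toStage13Params ((w1 F θ).u3Objects θ.γ) k))
    (hD4 : ∀ (F : T4Family) (θ : Stage13HParams F N) (hP : θ.Provisos₁₃CoPH F N), Rg F θ → θ.Admissible F N → ∀ k : ℕ,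
      ReadOutAt (datumOfRecord₁₃CoPH F N θ hP) (u3OfRecord₁₃ θ.toStage13Params ((w1 F θ).u3Objects θ.γ) k))
    (h20 : S_N20 (SRec₁₃CoPHOn cr Rg)) (h21 : S_N21 (SRec₁₃CoPHOn cr Rg))
    (hx : ∀ (F : T4Family) (θ : Stage13HParams F N) (hP : θ.Provisos₁₃CoPH F N), Rg F θ → θ.Admissible F N →
      B16.EndStatementBPrinted (datumOfRecord₁₃CoPH F N θ hP).C → DagBinding.EndpointExistence (datumOfRecord₁₃CoPH F N θ hP).C.toB12 →
        ForSmallCouplings (datumOfRecord₁₃CoPH F N θ hP) fun g₀ => ∀ os : List (ULoop F),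
          0 < (cr F θ hP g₀ os).l₀ ∧ 0 < (cr F θ hP g₀ os).vol ∧
          (∀ (K : ℕ) (t : ℝ), |t| ≤ (cr F θ hP g₀ os).l₀ →
            T4GenFunBounds.schemeZ ((datumOfRecord₁₃CoPH F N θ hP).scheme g₀) os ((cr F θ hP g₀ os).K₀ + K) t =
              ∑ τ ∈ (cr F θ hP g₀ os).T K, (cr F θ hP g₀ os).A K t τ) ∧
          (∀ (K : ℕ) (t : ℝ), |t| ≤ (cr F θ hP g₀ os).l₀ →
            T4GenFunBounds.schemeZ ((datumOfRecord₁₃CoPH F N θ hP).scheme g₀) os ((cr F θ hP g₀ os).K₀ + K + 1) t =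
              ∑ τ ∈ (cr F θ hP g₀ os).T K, (cr F θ hP g₀ os).B K t τ))
    (h19 : ∀ (ℓ₃ : T4Family → NE3Letters₁₁) (F : T4Family) (θ : Stage13HParams F N) (hP : θ.Provisos₁₃CoPH F N), Rg F θ → θ.Admissible F N → ∀ (g₀ : ℕ → ℝ) (os : List (ULoop F)),
      (∀ k : ℕ, RatesHolderAt (datumOfRecord₁₃CoPH F N θ hP) (rateCarriersOfRecord₁₃CoPH (readingOfRecord₁₃CoPH w1 ℓ₃ ne2 ne1) F θ hP g₀ os k) β) → letI := (cr F θ hP g₀ os).dec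
        ∃ δ : ℕ → ℝ, NE7.Core (cr F θ hP g₀ os).l₀ (cr F θ hP g₀ os).vol (cr F θ hP g₀ os).T (cr F θ hP g₀ os).Bad
          (fun K t τ => (cr F θ hP g₀ os).A K t τ - (cr F θ hP g₀ os).shA K t τ) (fun K t τ => (cr F θ hP g₀ os).B K t τ - (cr F θ hP g₀ os).shB K t τ) δ ∧
          Summable δ) :
    Spine (N := N) fun F D w => Node00.IsRecordOfRecord₁₃CCoPHOn F N Rg D w := by
  obtain ⟨ℓ₃, h16, -⟩ :=
    exists_letters_s_N16Holder_readingOfRecord₁₃CoPHOn_of_sockets_allTorus hβ0 hβ1 (Rg := Rg) (w1 := w1) (ne2 := ne2) (ne1 := ne1) hg hS h7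
  exact spine_rec13CCoPHOn_at_readingOfRecord₁₃CoPH_holder cr β w1 ne2 ne1 Rg ℓ₃
    ((s_N14_rRec₁₃CoPHOn_iff _ Rg).mpr fun F θ hP hRg hθ g₀ os => h14 F θ hP hRg hθ g₀ os)
    ((s_N15_rRec₁₃CoPHOn_iff _ Rg).mpr fun F θ hP hRg hθ g₀ os k => h15 F θ hP hRg hθ g₀ os k) h16
    ((s_N18_rRec₁₃CoPHOn_iff _ Rg).mpr fun F θ hP hRg hθ _ _ k => h18 F θ hP hRg hθ k)
    ((s_N22_rRec₁₃CoPHOn_iff _ Rg).mpr fun F θ hP hRg hθ _ _ k => h22 F θ hP hRg hθ k)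
    ((s_D4_rRec₁₃CoPHOn_iff _ Rg).mpr fun F θ hP hRg hθ _ _ k => hD4 F θ hP hRg hθ k) h20 h21 hx (h19 ℓ₃)

end Sockets

end Summit.QuantumFields.YangMills.Theorems.BalabanUVNodesN27SpineRecord
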